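import Literature.NumberTheory.DiophantineGeometry.SchurWeylHighestWeightProofs
import Literature.NumberTheory.DiophantineGeometry.SchurWeylPlethysmHwMultiplicityProofs
import Literature.NumberTheory.DiophantineGeometry.GLHighestWeightFacts
import HarnessLib

/-!
# Highest weights of the tensor power `(k^N)^{⊗d}` — discharge of `hasHighestWeight_glTensorRep_iff`

Proof of the named fact `Literature.NumberTheory.DiophantineGeometry.hasHighestWeight_glTensorRep_iff` of
`Literature.NumberTheory.DiophantineGeometry.SchurWeylPlethysm` (kept in a sibling file: the
proof imports the three proof files below, which themselves import the statement file):

* `Literature.NumberTheory.DiophantineGeometry.hasHighestWeight_glTensorRep_iff_holds` : for a field `k` of characteristic zero,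
  `N d : ℕ` and a weight `χ : Fin N → ℤ` of `GL_N`, the tensor power `(k^N)^{⊗d}`
  (`glTensorRep (Fin N) k d`, upper triangular Borel) has a nonzero `B`-semi-invariant of weight
  `χ` iff `χ = (μ_1, …, μ_N)` (`Weight.ofPartition N μ`) for a partition `μ ⊢ d` with at most `N`
  parts.

Source. W. Fulton, J. Harris, *Representation Theory. A First Course*, GTM 129 (1991),
Theorem 6.3 (PDF p. 118: "(1) Let `k = dim V`. Then `𝕊_λ V` is zero if `λ_{k+1} ≠ 0`. …
(2) … `V^{⊗d} ≅ ⊕ 𝕊_λ V^{⊕ m_λ}`", the sum over the partitions `λ` of `d`, `m_λ = dim V_λ > 0`)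
together with Proposition 15.15 (PDF p. 250: "`𝕊_λ(ℂ^n)` is the irreducible representation …
with highest weight `λ_1 L_1 + ⋯ + λ_n L_n`") and §15.5 (Prop. 15.47). Read on the spaces of
`B`-semi-invariants, (1)+(2)+15.15 say exactly that the highest weights of `V^{⊗d}`, `V = k^N`,
are the partitions of `d` with at most `N` rows; the vendored statement is this, over any field
of characteristic zero (Fulton–Harris work over `ℂ`). The statement is faithful.

## Proof

Everything needed is already in the tree; this file is glue.

* (`→`, `isPolynomial_of_hasHighestWeight_glTensorRep`, `size_eq_of_hasHighestWeight_glTensorRep`)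
  Pass to the coordinate model `wordRep k N d` of `(k^N)^{⊗d}` (`TensorWordModel.wordRepEquiv`,
  `hasHighestWeight_congr`). A nonzero highest-weight vector `c` of weight `χ` is supported on
  words of content `χ` (`apply_eq_zero_of_mem_highestWeightSpace`: the torus
  `diag(1, …, 2, …, 1)`), so `χ ≥ 0` (`highestWeightSpace_wordRep_eq_bot_of_neg`) and
  `∑ χ_i = d` (`sum_wordContent`); and `χ` is dominant, `χ_r ≥ χ_s` for `r < s`, by the
  `𝔰𝔩_2`-ladder of `SchurWeylPlethysmHwMultiplicityProofs`
  (`highestWeightSpace_wordRep_eq_bot_of_lt`: `c` is killed by the raising operator `E_{r s}`,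
  and `E F^{j+1} c = (j+1)(λ-j) F^j c` with `λ = χ_r - χ_s < 0` forces `c = 0`; Fulton–Harris
  §11.1, (11.5), and Prop. 15.15). A dominant nonnegative weight of size `d` is
  `Weight.ofPartition N μ` for a unique `μ ⊢ d` with at most `N` parts
  (`Weight.existsUnique_eq_ofPartition_holds`, file `GLHighestWeightFacts`).
* (`←`, `hasHighestWeight_glTensorRep_ofPartition`) The vector `w_μ = c_μ · e_T ∈ (k^N)^{⊗d}`
  (`hwVector`, file `SchurWeylHighestWeightProofs`; `T` the canonical tableau with row `i` filled
  with `i`) is nonzero (`hwVector_ne_zero`) and satisfies `g · w_μ = (∏_a g_{aa}^{μ_a}) w_μ` for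
  upper triangular `g` (`glTensorRep_hwVector`) — Fulton–Harris §15.5, proof of Prop. 15.15;
  Fulton, *Young Tableaux*, §8.2 Lemma 4.

## References

* W. Fulton, J. Harris, *Representation Theory. A First Course*, GTM 129, Springer 1991,
  Thm. 6.3 (1), (2) (PDF p. 118), Prop. 15.15 (PDF p. 250), §15.5 (Prop. 15.47, PDF p. 259),
  §11.1. doi:10.1007/978-1-4612-0979-9. [bib: FultonHarrisGTM129]
* W. Fulton, *Young Tableaux*, LMS Student Texts 35 (1997), §8.2 (Lemma 4, Thm. 2), §8.3 Cor. 1.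
  [bib: FultonYoungTableaux1997]

## Reused from the tree

`TensorWordModel`: `wordRepEquiv`, `apply_eq_zero_of_mem_highestWeightSpace`,
`highestWeightSpace_wordRep_eq_bot_of_neg`, `sum_wordContent`.
`SchurWeylPlethysmHwMultiplicityProofs`: `highestWeightSpace_wordRep_eq_bot_of_lt`.
`GLHighestWeightFacts`: `Weight.existsUnique_eq_ofPartition_holds`.
`SchurWeylHighestWeightProofs`: `hwVector`, `hwVector_ne_zero`, `glTensorRep_hwVector`.
`GLHighestWeight`: `hasHighestWeight_congr`, `hasHighestWeight_iff_exists`.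
-/

noncomputable section

open scoped BigOperators TensorProduct

namespace Literature.NumberTheory.DiophantineGeometry

section TensorHighestWeights

variable {k : Type*} [Field k] {N d : ℕ}

/-- **Highest weights of `(k^N)^{⊗d}` are dominant and nonnegative** (characteristic zero): if
`χ` is the weight of a nonzero `B`-semi-invariant of the tensor power, then
`χ_0 ≥ χ_1 ≥ ⋯ ≥ χ_{N-1} ≥ 0`. Nonnegativity: weight vectors live on words of content `χ`
(`highestWeightSpace_wordRep_eq_bot_of_neg`); dominance: the `𝔰𝔩_2`-ladder
(`highestWeightSpace_wordRep_eq_bot_of_lt`). Fulton–Harris Prop. 15.15 with §11.1 and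
Thm. 6.3 (2); Fulton, *Young Tableaux*, §8.2. [cite: FultonHarrisGTM129, Prop. 15.15] -/
theorem isPolynomial_of_hasHighestWeight_glTensorRep [CharZero k] {χ : Weight (Fin N)}
    (h : HasHighestWeight (glTensorRep (Fin N) k d) χ) : χ.IsPolynomial := by
  rw [hasHighestWeight_congr (wordRepEquiv k N d)] at h
  refine ⟨fun r s hrs => ?_, fun i => ?_⟩
  · by_contra hlt
    rw [not_le] at hlt
    rcases hrs.lt_or_eq with hrs' | rfl
    · exact h (highestWeightSpace_wordRep_eq_bot_of_lt hrs' hlt)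
    · exact lt_irrefl _ hlt
  · by_contra hneg
    rw [not_le] at hneg
    exact h (highestWeightSpace_wordRep_eq_bot_of_neg k hneg)

/-- **Highest weights of `(k^N)^{⊗d}` have size `d`** (characteristic zero): a nonzero
`B`-semi-invariant of weight `χ` has a nonzero coordinate at some word `w`, whose content is
then `χ` (`apply_eq_zero_of_mem_highestWeightSpace`), and contents add up to the number `d` of
letters. (The scalars `t · 1` act on `V^{⊗d}` by `t^d`.) Fulton–Harris §15.5; Fulton, *Young
Tableaux*, §8.2. [cite: FultonHarrisGTM129, §15.5] -/
theorem size_eq_of_hasHighestWeight_glTensorRep [CharZero k] {χ : Weight (Fin N)}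
    (h : HasHighestWeight (glTensorRep (Fin N) k d) χ) : χ.size = d := by
  rw [hasHighestWeight_congr (wordRepEquiv k N d), hasHighestWeight_iff_exists] at h
  obtain ⟨c, hc0, hc⟩ := h
  obtain ⟨w, hw⟩ : ∃ w, c w ≠ 0 := by
    by_contra hall
    push Not at hall
    exact hc0 (funext hall)
  have hcont : ∀ i, (wordContent w i : ℤ) = χ i := fun i =>
    by_contra fun hne => hw (apply_eq_zero_of_mem_highestWeightSpace k hc hne)
  calc χ.size = ∑ i, (wordContent w i : ℤ) := Finset.sum_congr rfl fun i _ => (hcont i).symm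
    _ = d := by rw [← Nat.cast_sum, sum_wordContent]

/-- **`(k^N)^{⊗d}` has the highest weight `μ`** for every partition `μ ⊢ d` with at most `N`
parts (characteristic zero), witnessed by `w_μ = c_μ · e_T` (`hwVector`), which is nonzero and
satisfies `g · w_μ = (∏_a g_{aa}^{μ_a}) w_μ` for upper triangular `g`. Fulton–Harris Thm. 6.3 (2)
with Prop. 15.15 (`𝕊_μ V ⊆ V^{⊗d}` occurs, with highest weight `μ`); Fulton, *Young Tableaux*,
§8.2 Lemma 4. [cite: FultonHarrisGTM129, Thm. 6.3 (2) with Prop. 15.15] -/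
theorem hasHighestWeight_glTensorRep_ofPartition [CharZero k] (μ : Nat.Partition d)
    (hμ : μ.parts.card ≤ N) :
    HasHighestWeight (glTensorRep (Fin N) k d) (Weight.ofPartition N μ) := by
  rw [hasHighestWeight_iff_exists]
  exact ⟨hwVector k μ hμ, hwVector_ne_zero μ hμ, fun g hg => glTensorRep_hwVector μ hμ hg⟩

variable (k)

/-- **Discharge of `hasHighestWeight_glTensorRep_iff`.** Over a field of characteristic zero,
the tensor power `(k^N)^{⊗d}` of the standard representation of `GL_N` has the highest weight
`χ` (a nonzero `B`-semi-invariant of weight `χ`, upper triangular Borel) iff `χ = (μ_1, …, μ_N)`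
for a partition `μ ⊢ d` with at most `N` parts. (`→`) a highest weight of `V^{⊗d}` is dominant,
nonnegative and of size `d` (`isPolynomial_of_hasHighestWeight_glTensorRep`,
`size_eq_of_hasHighestWeight_glTensorRep`), hence the weight of a partition of `d` with at most
`N` parts (`Weight.existsUnique_eq_ofPartition_holds`); (`←`)
`hasHighestWeight_glTensorRep_ofPartition`. This is Fulton–Harris Thm. 6.3 (1)–(2)
(`V^{⊗d} ≅ ⊕_{λ ⊢ d} 𝕊_λ V^{⊕ m_λ}`, `𝕊_λ V = 0` iff `λ` has more than `dim V` rows) read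
through Prop. 15.15 (`𝕊_λ(ℂ^n)` has highest weight `λ`), PDF pp. 118, 250; stated there over
`ℂ`, proved here over any field of characteristic zero by the elementary coordinate arguments of
`TensorWordModel` / `SchurWeylPlethysmHwMultiplicityProofs` / `SchurWeylHighestWeightProofs`.
[cite: FultonHarrisGTM129, Thm. 6.3 (1)-(2) with Prop. 15.15] -/
theorem hasHighestWeight_glTensorRep_iff_holds : hasHighestWeight_glTensorRep_iff k := by
  intro _ N d χ
  constructor
  · intro h
    have hpol := isPolynomial_of_hasHighestWeight_glTensorRep h
    have hsize := size_eq_of_hasHighestWeight_glTensorRep h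
    obtain ⟨μ, ⟨hμN, hμχ⟩, -⟩ := Weight.existsUnique_eq_ofPartition_holds hpol
    have hd : χ.size.toNat = d := by rw [hsize, Int.toNat_natCast]
    subst hd
    exact ⟨μ, hμN, hμχ.symm⟩
  · rintro ⟨μ, hμN, rfl⟩
    exact hasHighestWeight_glTensorRep_ofPartition μ hμN

end TensorHighestWeights

end Literature.NumberTheory.DiophantineGeometry
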